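import Mathlib
import Summits.CriticalPhenomena.CardyFormulaZ2.Theorems.CardySelfRefinementDefs
import Summits.CriticalPhenomena.CardyFormulaZ2.Theorems.CardySelfRefinementRussoDriftPolynomial
import Summits.CriticalPhenomena.CardyFormulaZ2.Theorems.CardySelfRefinementGradientComparabilityStubDrhoEqSignedSum
import Summits.CriticalPhenomena.CardyFormulaZ2.Theorems.CardySelfRefinementGradientComparabilityStubDcEqSumPivotal
import Literature.Probability.Percolation.PivotalCell
import Literature.Probability.Percolation.FourArmGarbanShift
import Literature.Probability.Percolation.SelfRefinementMeasure
import HarnessLib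

/-!
# Stub `stub_russoOrbit` of line `far-field-is-a-quarter-turn` (crux `TrivialSectorRate`,
stmt-CriticalPhenomena-10266): the RUSSO–ORBIT DECOMPOSITION

At every parameter point of `[0,1]²` and every mesh `η > 0` the two one-sided Russo derivatives of
the joint crossing probability are the orbit-grouped coin responses summed over a finite set of
coarse vertices: `∂ρP = Σ_u Tρ(u)`, `∂cP = Σ_u Tc(u)`.  Ingredients: the signed Russo formulas
within `[0,1]` on the coin side (`stub_Drho_eq_signed_sum`; `Dc_eq_sum_infl`, re-derived from
`stub_russoWithin_signed` exactly as in `stub_Dc_eq_sum_pivotal`); coins off the coin window have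
zero influence (`infl_eq_zero_of_not_mem`, from `determinedBy_preimage_Aloc`); and the regrouping
of finite sums — every bundle has two coarse endpoints (weight `½`, `sum_sum_bundlesAt`), every
non-axial edge is an interior edge of exactly one cell, that of its coarse base
(`tb_eq_of_mem_interiorEdges`, `mem_interiorEdges_tb`), and every cell has four corners
(weight `¼`, `sum_sum_cellsAt`).  Vocabulary: `Theorems/CardySelfRefinementDefs` (+ `FarField`).
-/

noncomputable section

namespace Summit.CriticalPhenomena.CardyFormulaZ2.Theorems.CardySelfRefinement.FarField

open scoped Topology
open Filter Set MeasureTheory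
open Literature.Probability.LatticeModels Literature.Probability.Percolation
open Literature.Probability.Percolation.QuadCrossing
open Summit.CriticalPhenomena.CardyFormulaZ2.Theses.CardySelfRefinement

/-! ## Zero influence off the window; the coin-side Russo formula in `c` -/

/-- A coin outside the coin window has zero influence on the localised joint crossing event: the
pulled-back event is determined by the window, on which `insert i S` and `S \ {i}` agree. -/
theorem infl_eq_zero_of_not_mem (k m : ℕ) (F : Fin m → Quad (univ : Set ℂ)) (η : ℝ) (q : ℝ × ℝ)
    {K : Finset Coin} (hK : (↑K : Set Coin) = coinWindow k (window m F η)) {i : Coin} (hi : i ∉ K) :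
    infl k m F η q i = 0 := by
  have hdet := determinedBy_preimage_Aloc k m F η
  rw [determinedBy_iff] at hdet
  have hiW : i ∉ coinWindow k (window m F η) := by
    rw [← hK]
    exact fun h => hi (Finset.mem_coe.1 h)
  have hset : {S : Set Coin | insert i S ∈ coinEvent k m F η} =
      {S | S \ {i} ∈ coinEvent k m F η} := by
    ext S
    simp only [Set.mem_setOf_eq]
    refine hdet _ _ ?_
    ext j
    simp only [Set.mem_inter_iff, Set.mem_insert_iff, Set.mem_sdiff, Set.mem_singleton_iff]
    constructor
    · rintro ⟨rfl | hj, hjW⟩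
      · exact absurd hjW hiW
      · exact ⟨⟨hj, fun hji => hiW (hji ▸ hjW)⟩, hjW⟩
    · rintro ⟨⟨hj, -⟩, hjW⟩
      exact ⟨Or.inr hj, hjW⟩
  rw [infl, hset, sub_self]

/-- **Coin-side Russo formula, `c`-direction** (as in `stub_Dc_eq_sum_pivotal`): for `η ≠ 0`,
`c ∈ [0,1]`, any `ρ`, `∂cP(ρ,c)` is the sum of the influences of the own coins of the non-axial
edges in the coin window. -/
theorem Dc_eq_sum_infl (k m : ℕ) (F : Fin m → Quad (univ : Set ℂ)) {η : ℝ} (hη : η ≠ 0) (ρ : ℝ)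
    {c : ℝ} (hc : c ∈ Set.Icc (0 : ℝ) 1) (K : Finset Coin)
    (hK : (↑K : Set Coin) = coinWindow k (window m F η)) :
    Dc k m F η (ρ, c) = ∑ i ∈ K with (i.2.2 = 0 ∧ ¬ ax k (i.1, i.2.1)), infl k m F η (ρ, c) i := by
  classical
  have hdet : DeterminedBy ((cfg k) ⁻¹' Aloc m F η) (↑K : Set Coin) :=
    hK ▸ determinedBy_preimage_Aloc k m F η
  have hfun : (fun c' => P k m F η ρ c') =
      fun c' => (prodBernoulli (prm k ρ c')).real ((cfg k) ⁻¹' Aloc m F η) := by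
    funext c'
    rw [P_eq_real_Aloc, map_measureReal_apply (measurable_cfg k) (measurableSet_Aloc m F hη)]
  have hderiv := stub_russoWithin_signed (fun b => prm k ρ b) ((cfg k) ⁻¹' Aloc m F η) hdet
    (Set.Icc 0 1) c (fun i => if i.2.2 = 0 ∧ ¬ ax k (i.1, i.2.1) then (1 : ℝ) else 0)
    (fun i _ => hasDerivWithinAt_prm_c k ρ i hc)
  have hD : Dc k m F η (ρ, c) = ∑ i ∈ K,
      (if i.2.2 = 0 ∧ ¬ ax k (i.1, i.2.1) then (1 : ℝ) else 0) * infl k m F η (ρ, c) i := by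
    show derivWithin (fun c' => P k m F η ρ c') (Set.Icc 0 1) c = _
    rw [hfun]
    exact hderiv.derivWithin (uniqueDiffOn_Icc zero_lt_one c hc)
  rw [hD]
  simp only [ite_mul, one_mul, zero_mul]
  exact (Finset.sum_filter _ _).symm

/-- The sum of a translate of a finitely supported function over a large enough finite set is its
total sum. -/
theorem sum_sub_eq_sum_support (g : Site 2 → ℝ) (T U : Finset (Site 2)) (v : Site 2)
    (hg : ∀ t, t ∉ T → g t = 0) (hU : ∀ t ∈ T, t + v ∈ U) :
    ∑ u ∈ U, g (u - v) = ∑ t ∈ T, g t := by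
  classical
  calc ∑ u ∈ U, g (u - v) = ∑ t ∈ U.image (fun u => u - v), g t :=
        (Finset.sum_image fun a _ b _ h => sub_left_injective h).symm
    _ = ∑ t ∈ T, g t := by
        refine (Finset.sum_subset (fun t ht => ?_) fun t _ htT => hg t htT).symm
        exact Finset.mem_image.2 ⟨t + v, hU t ht, add_sub_cancel_right t v⟩

/-- The translates by `e₀`, `e₁`, `e₀ + e₁` of a coarse vertex are pairwise distinct from it and
from each other. -/
theorem sub_single_ne (a : Site 2) :
    a - Pi.single 0 1 ≠ a ∧ a - Pi.single 1 1 ≠ a ∧ a - Pi.single 0 1 - Pi.single 1 1 ≠ a ∧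
      a - Pi.single 0 1 ≠ a - Pi.single 1 1 ∧
      a - Pi.single 0 1 - Pi.single 1 1 ≠ a - Pi.single 0 1 ∧
      a - Pi.single 0 1 - Pi.single 1 1 ≠ a - Pi.single 1 1 := by
  refine ⟨?_, ?_, ?_, ?_, ?_, ?_⟩ <;> intro h <;>
    · have h0 := congrFun h 0; have h1 := congrFun h 1; simp at h0 h1

/-- The bundle sum at `u`, written out over `(u,0)`, `(u,1)`, `(u − e₀,0)`, `(u − e₁,1)`. -/
theorem sum_bundlesAt (g : Site 2 × Fin 2 → ℝ) (u : Site 2) :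
    ∑ b ∈ bundlesAt u, g b =
      g (u, 0) + g (u, 1) + g (u - Pi.single 0 1, 0) + g (u - Pi.single 1 1, 1) := by
  obtain ⟨hA, hB, -, -, -, -⟩ := sub_single_ne u
  have h1 : (u - Pi.single 0 1, (0 : Fin 2)) ∉
      ({(u - Pi.single 1 1, (1 : Fin 2))} : Finset (Site 2 × Fin 2)) := by simp
  have h2 : (u, (1 : Fin 2)) ∉ ({(u - Pi.single 0 1, (0 : Fin 2)), (u - Pi.single 1 1, (1 : Fin 2))} :
      Finset (Site 2 × Fin 2)) := by simp [hB.symm]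
  have h3 : (u, (0 : Fin 2)) ∉ ({(u, (1 : Fin 2)), (u - Pi.single 0 1, (0 : Fin 2)),
      (u - Pi.single 1 1, (1 : Fin 2))} : Finset (Site 2 × Fin 2)) := by simp [hA.symm]
  rw [bundlesAt, Finset.sum_insert h3, Finset.sum_insert h2, Finset.sum_insert h1,
    Finset.sum_singleton]
  ring

/-- The cell sum at `u`, written out over `u`, `u − e₀`, `u − e₁`, `u − e₀ − e₁`. -/
theorem sum_cellsAt (g : Site 2 → ℝ) (u : Site 2) :
    ∑ t ∈ cellsAt u, g t =
      g u + g (u - Pi.single 0 1) + g (u - Pi.single 1 1) +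
        g (u - Pi.single 0 1 - Pi.single 1 1) := by
  obtain ⟨hA, hB, hC, hD, hE, hF⟩ := sub_single_ne u
  have h1 : u - Pi.single 1 1 ∉ ({u - Pi.single 0 1 - Pi.single 1 1} : Finset (Site 2)) := by
    simp [hF.symm]
  have h2 : u - Pi.single 0 1 ∉
      ({u - Pi.single 1 1, u - Pi.single 0 1 - Pi.single 1 1} : Finset (Site 2)) := by
    simp [hD, hE.symm]
  have h3 : u ∉ ({u - Pi.single 0 1, u - Pi.single 1 1, u - Pi.single 0 1 - Pi.single 1 1} :
      Finset (Site 2)) := by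
    simp [hA.symm, hB.symm, hC.symm]
  rw [cellsAt, Finset.sum_insert h3, Finset.sum_insert h2, Finset.sum_insert h1,
    Finset.sum_singleton]
  ring

/-- **Bundle regrouping**: if `g` vanishes off `B` and `U` contains both coarse endpoints of every
bundle of `B`, then `Σ_{u ∈ U} Σ_{b ∈ bundlesAt u} g b = 2 Σ_{b ∈ B} g b`. -/
theorem sum_sum_bundlesAt (g : Site 2 × Fin 2 → ℝ) (B : Finset (Site 2 × Fin 2))
    (hg : ∀ b, b ∉ B → g b = 0) (U : Finset (Site 2))
    (hU : ∀ b ∈ B, b.1 ∈ U ∧ b.1 + Pi.single b.2 1 ∈ U) :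
    ∑ u ∈ U, ∑ b ∈ bundlesAt u, g b = 2 * ∑ b ∈ B, g b := by
  classical
  have hdir : ∀ (d : Fin 2) (v : Site 2), (∀ b ∈ B, b.2 = d → b.1 + v ∈ U) →
      ∑ u ∈ U, g (u - v, d) = ∑ b ∈ B with b.2 = d, g b := by
    intro d v hv
    have hT : ∀ t, t ∉ (B.filter (fun b => b.2 = d)).image Prod.fst → g (t, d) = 0 :=
      fun t ht => hg _ fun hb => ht (Finset.mem_image.2 ⟨(t, d), Finset.mem_filter.2 ⟨hb, rfl⟩, rfl⟩)
    have hTU : ∀ t ∈ (B.filter (fun b => b.2 = d)).image Prod.fst, t + v ∈ U := by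
      intro t ht
      obtain ⟨b, hb, rfl⟩ := Finset.mem_image.1 ht
      exact hv b (Finset.mem_filter.1 hb).1 (Finset.mem_filter.1 hb).2
    rw [sum_sub_eq_sum_support (fun t => g (t, d)) _ U v hT hTU, Finset.sum_image]
    · refine Finset.sum_congr rfl fun b hb => ?_
      rw [← (Finset.mem_filter.1 hb).2]
    · rintro ⟨t, i⟩ hb ⟨t', i'⟩ hb' h
      have hi : i = d := (Finset.mem_filter.1 (Finset.mem_coe.1 hb)).2
      have hi' : i' = d := (Finset.mem_filter.1 (Finset.mem_coe.1 hb')).2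
      subst hi hi'
      simp only at h
      rw [h]
  have hfib : ∑ b ∈ B with b.2 = 0, g b + ∑ b ∈ B with b.2 = 1, g b = ∑ b ∈ B, g b := by
    rw [← Finset.sum_fiberwise B Prod.snd g, Fin.sum_univ_two]
  have h10 : ∀ b ∈ B, b.2 = 0 → b.1 + 0 ∈ U := fun b hb _ => by simpa using (hU b hb).1
  have h11 : ∀ b ∈ B, b.2 = 1 → b.1 + 0 ∈ U := fun b hb _ => by simpa using (hU b hb).1
  have h20 : ∀ b ∈ B, b.2 = 0 → b.1 + Pi.single 0 1 ∈ U := fun b hb hd => hd ▸ (hU b hb).2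
  have h21 : ∀ b ∈ B, b.2 = 1 → b.1 + Pi.single 1 1 ∈ U := fun b hb hd => hd ▸ (hU b hb).2
  calc ∑ u ∈ U, ∑ b ∈ bundlesAt u, g b
      = ∑ u ∈ U, (g (u, 0) + g (u, 1) + g (u - Pi.single 0 1, 0) + g (u - Pi.single 1 1, 1)) :=
        Finset.sum_congr rfl fun u _ => sum_bundlesAt g u
    _ = ∑ u ∈ U, g (u - 0, 0) + ∑ u ∈ U, g (u - 0, 1) + ∑ u ∈ U, g (u - Pi.single 0 1, 0) +
          ∑ u ∈ U, g (u - Pi.single 1 1, 1) := by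
        simp only [Finset.sum_add_distrib, sub_zero]
    _ = 2 * ∑ b ∈ B, g b := by
        rw [hdir 0 0 h10, hdir 1 0 h11, hdir 0 _ h20, hdir 1 _ h21, ← hfib]
        ring

/-- **Cell regrouping**: if `g` vanishes off `T` and `U` contains the four corners of every cell of
`T`, then `Σ_{u ∈ U} Σ_{t ∈ cellsAt u} g t = 4 Σ_{t ∈ T} g t`. -/
theorem sum_sum_cellsAt (g : Site 2 → ℝ) (T : Finset (Site 2)) (hg : ∀ t, t ∉ T → g t = 0)
    (U : Finset (Site 2)) (hU : ∀ t ∈ T, t ∈ U ∧ t + Pi.single 0 1 ∈ U ∧ t + Pi.single 1 1 ∈ U ∧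
      t + (Pi.single 0 1 + Pi.single 1 1) ∈ U) :
    ∑ u ∈ U, ∑ t ∈ cellsAt u, g t = 4 * ∑ t ∈ T, g t := by
  have h0 : ∀ t ∈ T, t + 0 ∈ U := fun t ht => by simpa using (hU t ht).1
  calc ∑ u ∈ U, ∑ t ∈ cellsAt u, g t
      = ∑ u ∈ U, (g u + g (u - Pi.single 0 1) + g (u - Pi.single 1 1) +
          g (u - Pi.single 0 1 - Pi.single 1 1)) :=
        Finset.sum_congr rfl fun u _ => sum_cellsAt g u
    _ = ∑ u ∈ U, g (u - 0) + ∑ u ∈ U, g (u - Pi.single 0 1) + ∑ u ∈ U, g (u - Pi.single 1 1) +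
          ∑ u ∈ U, g (u - (Pi.single 0 1 + Pi.single 1 1)) := by
        simp only [Finset.sum_add_distrib, sub_zero, sub_add_eq_sub_sub]
    _ = 4 * ∑ t ∈ T, g t := by
        rw [sum_sub_eq_sum_support g T U 0 hg h0,
          sum_sub_eq_sum_support g T U _ hg fun t ht => (hU t ht).2.1,
          sum_sub_eq_sum_support g T U _ hg fun t ht => (hU t ht).2.2.1,
          sum_sub_eq_sum_support g T U _ hg fun t ht => (hU t ht).2.2.2]
        ring

/-- An interior edge of the cell with base `t` has coarse base `t`. -/
theorem tb_eq_of_mem_interiorEdges {k : ℕ} (hk : 0 < k) {t : Site 2} {e : Site 2 × Fin 2}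
    (he : e ∈ interiorEdges k t) : tb k e = t := by
  classical
  simp only [interiorEdges, Finset.mem_filter, Finset.mem_image, Finset.mem_univ, true_and] at he
  obtain ⟨⟨p, rfl⟩, -⟩ := he
  have hk0 : (k : ℤ) ≠ 0 := by exact_mod_cast hk.ne'
  funext i
  have hj : 0 ≤ (![((p.1 : ℕ) : ℤ), ((p.2.1 : ℕ) : ℤ)] : Site 2) i ∧
      (![((p.1 : ℕ) : ℤ), ((p.2.1 : ℕ) : ℤ)] : Site 2) i < k := by
    fin_cases i
    · simp
    · simp
  simp only [tb]
  rw [Int.mul_add_ediv_left _ _ hk0, Int.ediv_eq_zero_of_lt hj.1 hj.2, add_zero]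

/-- A non-axial fine edge is an interior edge of the cell of its coarse base (`k > 0`). -/
theorem mem_interiorEdges_tb {k : ℕ} (hk : 0 < k) {e : Site 2 × Fin 2} (he : ¬ ax k e) :
    e ∈ interiorEdges k (tb k e) := by
  classical
  obtain ⟨v, d⟩ := e
  have hk0 : (k : ℤ) ≠ 0 := by exact_mod_cast hk.ne'
  have hkpos : (0 : ℤ) < k := by exact_mod_cast hk
  have hnn : ∀ i, 0 ≤ v i % (k : ℤ) := fun i => Int.emod_nonneg _ hk0
  have hlt' : ∀ i, (v i % (k : ℤ)).toNat < k := fun i =>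
    (Int.toNat_lt (hnn i)).2 (Int.emod_lt_of_pos _ hkpos)
  simp only [interiorEdges, Finset.mem_filter, Finset.mem_image, Finset.mem_univ, true_and]
  refine ⟨⟨(⟨_, hlt' 0⟩, ⟨_, hlt' 1⟩, d), ?_⟩, he⟩
  simp only [Prod.mk.injEq, and_true]
  funext i
  fin_cases i
  · simp [Int.toNat_of_nonneg (hnn 0), Int.mul_ediv_add_emod]
  · simp [Int.toNat_of_nonneg (hnn 1), Int.mul_ediv_add_emod]

/-- Distinct cells have disjoint sets of interior edges. -/
theorem pairwiseDisjoint_interiorEdges {k : ℕ} (hk : 0 < k) (T : Finset (Site 2)) :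
    (↑T : Set (Site 2)).PairwiseDisjoint (interiorEdges k) := by
  intro t _ t' _ htt'
  rw [Function.onFun, Finset.disjoint_left]
  intro e he he'
  exact htt' ((tb_eq_of_mem_interiorEdges hk he).symm.trans (tb_eq_of_mem_interiorEdges hk he'))

/-! ## The two orbit identities and the stub -/

/-- **`ρ`-identity**: if `U` contains both coarse endpoints of the bundle of every window selector
coin, then `Σ_{u ∈ U} Tρ(u)` is the sum of the influences of the window selector coins. -/
theorem sum_Tρ_eq (k m : ℕ) (F : Fin m → Quad (univ : Set ℂ)) (η : ℝ) (q : ℝ × ℝ)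
    (K : Finset Coin) (hK : (↑K : Set Coin) = coinWindow k (window m F η)) (U : Finset (Site 2))
    (hU : ∀ i ∈ K, i.2.2 = 2 → i.1 ∈ U ∧ i.1 + Pi.single i.2.1 1 ∈ U) :
    ∑ u ∈ U, Tρ k m F η q u = ∑ i ∈ K with i.2.2 = 2, infl k m F η q i := by
  classical
  have hzero : ∀ i, i ∉ K → infl k m F η q i = 0 := fun i hi =>
    infl_eq_zero_of_not_mem k m F η q hK hi
  have hmem : ∀ b : Site 2 × Fin 2,
      b ∈ (K.filter (fun i : Coin => i.2.2 = 2)).image (fun i => (i.1, i.2.1)) ↔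
        (b.1, b.2, (2 : Fin 3)) ∈ K := by
    rintro ⟨t, d⟩
    refine ⟨fun hb => ?_, fun hb => Finset.mem_image.2 ⟨(t, d, 2), Finset.mem_filter.2 ⟨hb, rfl⟩, rfl⟩⟩
    obtain ⟨⟨t', d', j⟩, hi, h⟩ := Finset.mem_image.1 hb
    simp only [Prod.mk.injEq] at h
    obtain ⟨rfl, rfl⟩ := h
    obtain ⟨hiK, hj⟩ := Finset.mem_filter.1 hi
    simp only at hj
    subst hj
    exact hiK
  have hg : ∀ b : Site 2 × Fin 2,
      b ∉ (K.filter (fun i : Coin => i.2.2 = 2)).image (fun i => (i.1, i.2.1)) →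
        infl k m F η q (b.1, b.2, 2) = 0 :=
    fun b hb => hzero _ fun hbK => hb ((hmem b).2 hbK)
  have hsum := sum_sum_bundlesAt (fun b => infl k m F η q (b.1, b.2, 2)) _ hg U
    fun b hb => hU _ ((hmem b).1 hb) rfl
  have hinj : Set.InjOn (fun i : Coin => (i.1, i.2.1))
      ↑(K.filter (fun i : Coin => i.2.2 = 2)) := by
    rintro ⟨v, d, j⟩ hi ⟨v', d', j'⟩ hi' h
    have hj : j = 2 := (Finset.mem_filter.1 (Finset.mem_coe.1 hi)).2
    have hj' : j' = 2 := (Finset.mem_filter.1 (Finset.mem_coe.1 hi')).2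
    simp only [Prod.mk.injEq] at h
    obtain ⟨rfl, rfl⟩ := h
    rw [hj, hj']
  calc ∑ u ∈ U, Tρ k m F η q u
      = (1 / 2 : ℝ) * ∑ u ∈ U, ∑ b ∈ bundlesAt u, infl k m F η q (b.1, b.2, 2) := by
        simp only [Tρ, Finset.mul_sum]
    _ = ∑ b ∈ (K.filter (fun i : Coin => i.2.2 = 2)).image (fun i => (i.1, i.2.1)),
          infl k m F η q (b.1, b.2, 2) := by
        rw [hsum]
        ring
    _ = ∑ i ∈ K with i.2.2 = 2, infl k m F η q (i.1, i.2.1, 2) := Finset.sum_image hinj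
    _ = ∑ i ∈ K with i.2.2 = 2, infl k m F η q i :=
        Finset.sum_congr rfl fun i hi => by
          obtain ⟨v, d, j⟩ := i
          have hj : j = 2 := (Finset.mem_filter.1 hi).2
          subst hj
          rfl

/-- **`c`-identity**: if `U` contains the four corners of the cell of every window own coin of a
non-axial edge, then `Σ_{u ∈ U} Tc(u)` is the sum of the influences of those coins (`k > 0`). -/
theorem sum_Tc_eq (k m : ℕ) (hk : 0 < k) (F : Fin m → Quad (univ : Set ℂ)) (η : ℝ) (q : ℝ × ℝ)
    (K : Finset Coin) (hK : (↑K : Set Coin) = coinWindow k (window m F η)) (U : Finset (Site 2))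
    (hU : ∀ i ∈ K, i.2.2 = 0 → ¬ ax k (i.1, i.2.1) →
      tb k (i.1, i.2.1) ∈ U ∧ tb k (i.1, i.2.1) + Pi.single 0 1 ∈ U ∧
        tb k (i.1, i.2.1) + Pi.single 1 1 ∈ U ∧
        tb k (i.1, i.2.1) + (Pi.single 0 1 + Pi.single 1 1) ∈ U) :
    ∑ u ∈ U, Tc k m F η q u =
      ∑ i ∈ K with (i.2.2 = 0 ∧ ¬ ax k (i.1, i.2.1)), infl k m F η q i := by
  classical
  have hzero : ∀ i, i ∉ K → infl k m F η q i = 0 := fun i hi =>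
    infl_eq_zero_of_not_mem k m F η q hK hi
  have hg : ∀ t, t ∉ (K.filter (fun i : Coin => i.2.2 = 0 ∧ ¬ ax k (i.1, i.2.1))).image
      (fun i => tb k (i.1, i.2.1)) → ∑ e ∈ interiorEdges k t, infl k m F η q (e.1, e.2, 0) = 0 := by
    intro t ht
    refine Finset.sum_eq_zero fun e he => hzero _ fun heK => ht ?_
    rw [← tb_eq_of_mem_interiorEdges hk he]
    exact Finset.mem_image.2
      ⟨(e.1, e.2, 0), Finset.mem_filter.2 ⟨heK, rfl, (Finset.mem_filter.1 he).2⟩, rfl⟩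
  have hT : ∀ t ∈ (K.filter (fun i : Coin => i.2.2 = 0 ∧ ¬ ax k (i.1, i.2.1))).image
      (fun i => tb k (i.1, i.2.1)), t ∈ U ∧ t + Pi.single 0 1 ∈ U ∧ t + Pi.single 1 1 ∈ U ∧
        t + (Pi.single 0 1 + Pi.single 1 1) ∈ U := by
    intro t ht
    obtain ⟨i, hi, rfl⟩ := Finset.mem_image.1 ht
    obtain ⟨hiK, hi0, hax⟩ := Finset.mem_filter.1 hi
    exact hU i hiK hi0 hax
  have hsum := sum_sum_cellsAt (fun t => ∑ e ∈ interiorEdges k t, infl k m F η q (e.1, e.2, 0)) _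
    hg U hT
  have hinj : Set.InjOn (fun i : Coin => (i.1, i.2.1))
      ↑(K.filter (fun i : Coin => i.2.2 = 0 ∧ ¬ ax k (i.1, i.2.1))) := by
    rintro ⟨v, d, j⟩ hi ⟨v', d', j'⟩ hi' h
    have hj : j = 0 := (Finset.mem_filter.1 (Finset.mem_coe.1 hi)).2.1
    have hj' : j' = 0 := (Finset.mem_filter.1 (Finset.mem_coe.1 hi')).2.1
    simp only [Prod.mk.injEq] at h
    obtain ⟨rfl, rfl⟩ := h
    rw [hj, hj']
  symm
  calc ∑ i ∈ K with (i.2.2 = 0 ∧ ¬ ax k (i.1, i.2.1)), infl k m F η q i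
      = ∑ i ∈ K with (i.2.2 = 0 ∧ ¬ ax k (i.1, i.2.1)), infl k m F η q (i.1, i.2.1, 0) :=
        Finset.sum_congr rfl fun i hi => by
          obtain ⟨v, d, j⟩ := i
          have hj : j = 0 := (Finset.mem_filter.1 hi).2.1
          subst hj
          rfl
    _ = ∑ e ∈ (K.filter (fun i : Coin => i.2.2 = 0 ∧ ¬ ax k (i.1, i.2.1))).image
          (fun i => (i.1, i.2.1)), infl k m F η q (e.1, e.2, 0) := by rw [Finset.sum_image hinj]
    _ = ∑ e ∈ ((K.filter (fun i : Coin => i.2.2 = 0 ∧ ¬ ax k (i.1, i.2.1))).image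
          (fun i => tb k (i.1, i.2.1))).biUnion (interiorEdges k), infl k m F η q (e.1, e.2, 0) := by
        refine Finset.sum_subset (fun e he => ?_) fun e he he' => ?_
        · obtain ⟨i, hi, rfl⟩ := Finset.mem_image.1 he
          obtain ⟨-, -, hax⟩ := Finset.mem_filter.1 hi
          exact Finset.mem_biUnion.2 ⟨_, Finset.mem_image_of_mem _ hi, mem_interiorEdges_tb hk hax⟩
        · obtain ⟨t, -, het⟩ := Finset.mem_biUnion.1 he
          have hax : ¬ ax k e := (Finset.mem_filter.1 het).2
          refine hzero _ fun heK => he' ?_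
          exact Finset.mem_image.2 ⟨(e.1, e.2, 0), Finset.mem_filter.2 ⟨heK, rfl, hax⟩, rfl⟩
    _ = ∑ t ∈ (K.filter (fun i : Coin => i.2.2 = 0 ∧ ¬ ax k (i.1, i.2.1))).image
          (fun i => tb k (i.1, i.2.1)), ∑ e ∈ interiorEdges k t, infl k m F η q (e.1, e.2, 0) :=
        Finset.sum_biUnion (pairwiseDisjoint_interiorEdges hk _)
    _ = ∑ u ∈ U, Tc k m F η q u := by
        simp only [Tc]
        rw [← Finset.mul_sum, hsum]
        ring

/-- **Russo–orbit decomposition** (registered stub `stub_russoOrbit` of crux stmt-CriticalPhenomena-10266,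
line `far-field-is-a-quarter-turn`): for `k = 2, 3`, `q ∈ [0,1]²`, `η > 0` and every finite quad family
there is a finite set `U` of coarse vertices with `∂ρP = Σ_{u∈U} Tρ(u)` and `∂cP = Σ_{u∈U} Tc(u)`. -/
theorem stub_russoOrbit :
    ∀ k : ℕ, k = 2 ∨ k = 3 → ∀ q : ℝ × ℝ, q ∈ Set.Icc (0 : ℝ) 1 ×ˢ Set.Icc (0 : ℝ) 1 → ∀ η : ℝ, 0 < η →
      ∀ (m : ℕ) (F : Fin m → Quad (univ : Set ℂ)), ∃ U : Finset (Site 2),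
        Dρ k m F η q = ∑ u ∈ U, Tρ k m F η q u ∧ Dc k m F η q = ∑ u ∈ U, Tc k m F η q u := by
  classical
  rintro k hk ⟨ρ, c⟩ hq η hη m F
  have hkpos : 0 < k := by rcases hk with rfl | rfl <;> norm_num
  obtain ⟨hρ, hc⟩ := Set.mem_prod.1 hq
  obtain ⟨K, hK⟩ := exists_coinFinset k m F hη.ne'
  refine ⟨K.biUnion fun i => ({i.1, i.1 + Pi.single i.2.1 1, tb k (i.1, i.2.1),
      tb k (i.1, i.2.1) + Pi.single 0 1, tb k (i.1, i.2.1) + Pi.single 1 1,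
      tb k (i.1, i.2.1) + (Pi.single 0 1 + Pi.single 1 1)} : Finset (Site 2)), ?_, ?_⟩
  · calc Dρ k m F η (ρ, c) = ∑ i ∈ K with i.2.2 = 2, infl k m F η (ρ, c) i :=
          stub_Drho_eq_signed_sum k m F hη.ne' hρ c K hK
      _ = _ := (sum_Tρ_eq k m F η (ρ, c) K hK _ fun i hi _ =>
          ⟨Finset.mem_biUnion.2 ⟨i, hi, by simp⟩, Finset.mem_biUnion.2 ⟨i, hi, by simp⟩⟩).symm
  · calc Dc k m F η (ρ, c) = ∑ i ∈ K with (i.2.2 = 0 ∧ ¬ ax k (i.1, i.2.1)), infl k m F η (ρ, c) i :=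
          Dc_eq_sum_infl k m F hη.ne' ρ hc K hK
      _ = _ := (sum_Tc_eq k m hkpos F η (ρ, c) K hK _ fun i hi _ _ =>
          ⟨Finset.mem_biUnion.2 ⟨i, hi, by simp⟩, Finset.mem_biUnion.2 ⟨i, hi, by simp⟩,
            Finset.mem_biUnion.2 ⟨i, hi, by simp⟩, Finset.mem_biUnion.2 ⟨i, hi, by simp⟩⟩).symm

end Summit.CriticalPhenomena.CardyFormulaZ2.Theorems.CardySelfRefinement.FarField

end
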